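import Summits.AtomisticToContinuum.Crystallization.Theorems.OverbindingBudgetAffineCompressedCutClasses
import Summits.AtomisticToContinuum.Crystallization.Theorems.OverbindingBudgetAffineCompressedCutTransfer
import Summits.AtomisticToContinuum.Crystallization.Theorems.OverbindingBudgetAffineCompressedCutOp

/-!
# NODE g79 «CompressedCut», toward the open leaf NS♭₂ — ONE TRANSPORT STEP AT THE RECORD CONSTANTS (sixth brick of the FRAME half; glue of bricks 1–5)

Route `OverbindingBudget` (Crystallization), crux `RobustDefectLimitWindows` (stmt-AtomisticToContinuum-31280), decomp-a2c lens 4, generation 79, ADDENDUM 9.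
This file INSTANTIATES the abstract one-step transport `…CompressedCutOp.transport_step_exists` in the setting of the dictionary (`…CompressedCutDict`): two
affinely framed sites `j`, `k = f v_k` (`v_k` a FIRST-SHELL point of `j`'s pattern), frames `(A, Q, P, f)`, `(A', Q', P', f')` at `(ε, θ, g) = (10⁻⁴, 10⁻³, 1/450)`,
patterns `P, P' ∈ {fcc, hcp}` two-shell, `k` exhaustive within `(3/2 + g)·nn_k`, and the SCALE half's comparison `9967/10⁴·nn_j ≤ nn_k ≤ 10011/10⁴·nn_j`:

* §1 `tetra_exists_pattern`: a first-shell point `v_k` of a two-shell pattern is a vertex of a regular unit tetrahedron `{0, v_k, b, c}` of pattern points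
  (`…Transfer.tetra_exists` pulled back through `…Transfer.exists_model_of_mem`); `partners_tetra`: then `(−v_k, b − v_k, c − v_k)` is a tetrahedral unit triple;
* §2 `site_ne_of_adjacent` (distinct adjacent pattern points register distinct sites), `dist_base_le` (`dist (y j) (y k) ≤ (3/2 + g)·nn_k`);
* §3 ★★ `transport_step_record`: there is an EXACT linear isometry `R₁` with `‖nn_k·A' x − nn_j·A (R₁ x)‖ ≤ (5/2)·(2ε·nn_j + ε·nn_k)·‖x‖` for EVERY `x`, and the
  back-pointer `w₀ ∈ P'` (`f' w₀ = y j`) has `R₁ w₀ = −v_k` — the input `hstep` of `…CompressedCutChain.transport_chain` / `chain_budget_const`, produced from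
  Dict (`dict_base`, `dict_step`, `dict_reach_record`, `dict_normClass_record`) + Classes (`frame_insert_zero`, `dict_gram_record`) + Transfer + Op.

Deps: tree only (the riders Classes ⊇ Dict, Transfer, Op).  No `instance`, no `notation`, no `set_option`, no new axioms, 0 sorry.
-/

namespace Summit.AtomisticToContinuum.Crystallization.Theorems.OverbindingBudgetAffineCompressedCutStep

open Literature.Geometry.DiscreteGeometry (nearestDist nearestDist_nonneg fccTwoShellPattern hcpTwoShellPattern sqNormInt intVec dist_sq_intVec_div)
open Summit.AtomisticToContinuum.Crystallization.Theorems.OverbindingBudgetAffineCompressedCutDict (le_frame_diff dict_step dict_base dict_reach_record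
  dict_normClass_record)
open Summit.AtomisticToContinuum.Crystallization.Theorems.OverbindingBudgetAffineCompressedCutClasses (frame_insert_zero dict_gram_record)
open Summit.AtomisticToContinuum.Crystallization.Theorems.OverbindingBudgetAffineCompressedCutTransfer (exists_model_of_mem sqNormInt_eq_of_norm_eq_one
  tetra_exists)
open Summit.AtomisticToContinuum.Crystallization.Theorems.OverbindingBudgetAffineCompressedCutOp (norm_eq_one_of_sqNormInt inner_eq_half_of_tetra
  transport_step_exists)

variable {N : ℕ}

/-! ## §1  Tetrahedra at a first-shell point of a two-shell pattern -/

/-- Adjacent model vectors give pattern points at distance `1`. [this file] -/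
theorem dist_eq_one_of_sqNormInt_sub {V W : Fin 3 → ℤ} (h : sqNormInt (V - W) = 18) :
    dist ((Real.sqrt 18)⁻¹ • intVec V) ((Real.sqrt 18)⁻¹ • intVec W) = 1 := by
  have h2 := dist_sq_intVec_div V W
  rw [h] at h2
  have h3 : dist ((Real.sqrt 18)⁻¹ • intVec V) ((Real.sqrt 18)⁻¹ • intVec W) ^ 2 = 1 := by rw [h2]; norm_num
  nlinarith [h3, dist_nonneg (x := (Real.sqrt 18)⁻¹ • intVec V) (y := (Real.sqrt 18)⁻¹ • intVec W)]

/-- **A first-shell point of a two-shell pattern is a vertex of a regular unit tetrahedron `{0, v_k, b, c}` of pattern points.** [this file] -/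
theorem tetra_exists_pattern {P : Finset (EuclideanSpace ℝ (Fin 3))} (hP : P = fccTwoShellPattern ∨ P = hcpTwoShellPattern)
    {vk : EuclideanSpace ℝ (Fin 3)} (hvk : vk ∈ P) (hvk1 : ‖vk‖ = 1) :
    ∃ b ∈ P, ∃ c ∈ P, ‖b‖ = 1 ∧ ‖c‖ = 1 ∧ dist vk b = 1 ∧ dist vk c = 1 ∧ dist b c = 1 ∧
      inner ℝ vk b = 1 / 2 ∧ inner ℝ vk c = 1 / 2 ∧ inner ℝ b c = 1 / 2 := by
  obtain ⟨S, hS, hPS, Vk, hVk, hvk_eq⟩ := exists_model_of_mem hP hvk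
  have n18 : sqNormInt Vk = 18 := sqNormInt_eq_of_norm_eq_one (by rw [← hvk_eq]; exact hvk1)
  obtain ⟨B, hB, C, hC, hB18, hC18, hAB, hAC, hBC⟩ := tetra_exists hS Vk hVk n18
  refine ⟨(Real.sqrt 18)⁻¹ • intVec B, ?_, (Real.sqrt 18)⁻¹ • intVec C, ?_, norm_eq_one_of_sqNormInt hB18, norm_eq_one_of_sqNormInt hC18,
    ?_, ?_, dist_eq_one_of_sqNormInt_sub hBC, ?_, ?_, inner_eq_half_of_tetra hB18 hC18 hBC⟩
  · rw [hPS]; exact Finset.mem_image_of_mem _ hB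
  · rw [hPS]; exact Finset.mem_image_of_mem _ hC
  · rw [hvk_eq]; exact dist_eq_one_of_sqNormInt_sub hAB
  · rw [hvk_eq]; exact dist_eq_one_of_sqNormInt_sub hAC
  · rw [hvk_eq]; exact inner_eq_half_of_tetra n18 hB18 hAB
  · rw [hvk_eq]; exact inner_eq_half_of_tetra n18 hC18 hAC

/-- The partner triple `(−v_k, b − v_k, c − v_k)` of a unit tetrahedron `{0, v_k, b, c}` is a tetrahedral unit triple. [this file] -/
theorem partners_tetra {vk b c : EuclideanSpace ℝ (Fin 3)} (hvk1 : ‖vk‖ = 1) (hb1 : ‖b‖ = 1) (hc1 : ‖c‖ = 1)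
    (ivb : inner ℝ vk b = 1 / 2) (ivc : inner ℝ vk c = 1 / 2) (ibc : inner ℝ b c = 1 / 2) :
    ‖-vk‖ = 1 ∧ ‖b - vk‖ = 1 ∧ ‖c - vk‖ = 1 ∧
      inner ℝ (-vk) (b - vk) = 1 / 2 ∧ inner ℝ (-vk) (c - vk) = 1 / 2 ∧ inner ℝ (b - vk) (c - vk) = 1 / 2 := by
  have ibv : inner ℝ b vk = 1 / 2 := by rw [real_inner_comm]; exact ivb
  have icv : inner ℝ c vk = 1 / 2 := by rw [real_inner_comm]; exact ivc
  have hvv : inner ℝ vk vk = 1 := by rw [real_inner_self_eq_norm_sq, hvk1]; norm_num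
  have nb : ‖b - vk‖ = 1 := by
    have h := norm_sub_sq_real b vk
    rw [hb1, hvk1, ibv] at h
    have h1 : ‖b - vk‖ ^ 2 = 1 := by rw [h]; norm_num
    nlinarith [norm_nonneg (b - vk)]
  have nc : ‖c - vk‖ = 1 := by
    have h := norm_sub_sq_real c vk
    rw [hc1, hvk1, icv] at h
    have h1 : ‖c - vk‖ ^ 2 = 1 := by rw [h]; norm_num
    nlinarith [norm_nonneg (c - vk)]
  refine ⟨by rw [norm_neg, hvk1], nb, nc, ?_, ?_, ?_⟩
  · rw [inner_neg_left, inner_sub_right, ivb, hvv]; norm_num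
  · rw [inner_neg_left, inner_sub_right, ivc, hvv]; norm_num
  · rw [inner_sub_left, inner_sub_right, inner_sub_right, ibc, ibv, ivc, hvv]; norm_num

/-! ## §2  Distinct adjacent pattern points register distinct sites; the base site is within reach -/

/-- Two pattern points at distance `1` register DISTINCT sites (frame tolerance `10⁻³`, registration `10⁻⁴`). [this file] -/
theorem site_ne_of_adjacent {y : Fin N → EuclideanSpace ℝ (Fin 3)} {j : Fin N}
    {A : EuclideanSpace ℝ (Fin 3) →ₗ[ℝ] EuclideanSpace ℝ (Fin 3)} {Q : EuclideanSpace ℝ (Fin 3) →ₗᵢ[ℝ] EuclideanSpace ℝ (Fin 3)}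
    {P : Finset (EuclideanSpace ℝ (Fin 3))} {f : EuclideanSpace ℝ (Fin 3) → EuclideanSpace ℝ (Fin 3)} (hs : 0 < nearestDist y j)
    (hA : ∀ v ∈ P, ‖A v - Q v‖ ≤ 1 / 1000)
    (hfj : ∀ v ∈ P, f v ∈ Set.range y ∧ dist (f v) (y j + nearestDist y j • A v) ≤ 1 / 10 ^ 4 * nearestDist y j)
    {v w : EuclideanSpace ℝ (Fin 3)} (hv : v ∈ P) (hw : w ∈ P) (hd : dist v w = 1) : f v ≠ f w := by
  intro hfe
  set s := nearestDist y j with hs_def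
  have h1 := (hfj v hv).2
  have h2 := (hfj w hw).2
  rw [hfe] at h1
  have h3 : dist (y j + s • A v) (y j + s • A w) = s * ‖A v - A w‖ := by
    rw [dist_add_left, dist_eq_norm, ← smul_sub, norm_smul, Real.norm_of_nonneg hs.le]
  have h4 := dist_triangle_left (y j + s • A v) (y j + s • A w) (f w)
  rw [h3] at h4
  have h5 := le_frame_diff hA hv hw
  rw [← dist_eq_norm, hd] at h5
  have h6 : s * (1 - 2 * (1 / 1000)) ≤ s * ‖A v - A w‖ := mul_le_mul_of_nonneg_left h5 hs.le
  nlinarith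

/-- The base site `j` is within the exhaustive radius of `k = f v_k` (`‖v_k‖ = 1`): `dist (y j) (y k) ≤ (3/2 + 1/450)·nn_k`. [this file] -/
theorem dist_base_le {y : Fin N → EuclideanSpace ℝ (Fin 3)} {j k : Fin N}
    {A : EuclideanSpace ℝ (Fin 3) →ₗ[ℝ] EuclideanSpace ℝ (Fin 3)} {Q : EuclideanSpace ℝ (Fin 3) →ₗᵢ[ℝ] EuclideanSpace ℝ (Fin 3)}
    {P : Finset (EuclideanSpace ℝ (Fin 3))} {f : EuclideanSpace ℝ (Fin 3) → EuclideanSpace ℝ (Fin 3)}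
    (hA : ∀ v ∈ P, ‖A v - Q v‖ ≤ 1 / 1000)
    (hfj : ∀ v ∈ P, f v ∈ Set.range y ∧ dist (f v) (y j + nearestDist y j • A v) ≤ 1 / 10 ^ 4 * nearestDist y j)
    {vk : EuclideanSpace ℝ (Fin 3)} (hvk : vk ∈ P) (hvk1 : ‖vk‖ = 1) (hfvk : f vk = y k)
    (hsc : 9967 / 10000 * nearestDist y j ≤ nearestDist y k) :
    dist (y j) (y k) ≤ (3 / 2 + 1 / 450) * nearestDist y k := by
  set s := nearestDist y j with hs_def
  have hs0 : 0 ≤ s := nearestDist_nonneg y j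
  have h1 := (hfj vk hvk).2
  rw [hfvk] at h1
  have hAvk : ‖A vk‖ ≤ 1 + 1 / 1000 := by
    have h := hA vk hvk
    have hq : ‖Q vk‖ = 1 := by rw [Q.norm_map, hvk1]
    have t : ‖A vk‖ ≤ ‖Q vk‖ + ‖A vk - Q vk‖ := by
      have := norm_add_le (Q vk) (A vk - Q vk)
      rwa [add_sub_cancel] at this
    linarith
  have h2 : dist (y j) (y j + s • A vk) = s * ‖A vk‖ := by
    rw [dist_comm, dist_eq_norm, add_sub_cancel_left, norm_smul, Real.norm_of_nonneg hs0]
  have h3 := dist_triangle (y j) (y j + s • A vk) (y k)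
  rw [h2, dist_comm (y j + s • A vk) (y k)] at h3
  have h4 : s * ‖A vk‖ ≤ s * (1 + 1 / 1000) := mul_le_mul_of_nonneg_left hAvk hs0
  nlinarith [nearestDist_nonneg y k]

/-! ## §3  The record transport step -/

/-- ★★ **ONE TRANSPORT STEP AT THE RECORD CONSTANTS** `(ε, θ, g) = (10⁻⁴, 10⁻³, 1/450)`.  Sites `j` (frame `A, Q, P, f`) and `k = f v_k` (frame `A', Q', P', f'`),
`v_k ∈ P` a FIRST-SHELL point, `k` exhaustive within `(3/2 + g)·nn_k`, patterns in `{fcc, hcp}`, scales compared by the SCALE half: there is an EXACT linear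
isometry `R₁` with `‖nn_k·A' x − nn_j·A (R₁ x)‖ ≤ (5/2)·(2ε·nn_j + ε·nn_k)·‖x‖` for every `x`, under which the back-pointer `w₀` (`f' w₀ = y j`) goes to `−v_k`.
Assembly: `tetra_exists_pattern` (b, c) → `dict_base` / `dict_step` (w₀, w₁, w₂) → `dict_normClass_record` + `dict_gram_record` (the w's form a tetrahedral unit
triple) → `…Op.transport_step_exists`. [this file] -/
theorem transport_step_record {y : Fin N → EuclideanSpace ℝ (Fin 3)} {j k : Fin N}
    {A A' : EuclideanSpace ℝ (Fin 3) →ₗ[ℝ] EuclideanSpace ℝ (Fin 3)} {Q Q' : EuclideanSpace ℝ (Fin 3) →ₗᵢ[ℝ] EuclideanSpace ℝ (Fin 3)}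
    {P P' : Finset (EuclideanSpace ℝ (Fin 3))} {f f' : EuclideanSpace ℝ (Fin 3) → EuclideanSpace ℝ (Fin 3)}
    (hs : 0 < nearestDist y j) (hsc : 9967 / 10000 * nearestDist y j ≤ nearestDist y k) (hsc' : nearestDist y k ≤ 10011 / 10000 * nearestDist y j)
    (hP : P = fccTwoShellPattern ∨ P = hcpTwoShellPattern) (hP' : P' = fccTwoShellPattern ∨ P' = hcpTwoShellPattern)
    (hA : ∀ v ∈ P, ‖A v - Q v‖ ≤ 1 / 1000) (hA' : ∀ w ∈ P', ‖A' w - Q' w‖ ≤ 1 / 1000)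
    (hfj : ∀ v ∈ P, f v ∈ Set.range y ∧ dist (f v) (y j + nearestDist y j • A v) ≤ 1 / 10 ^ 4 * nearestDist y j)
    (hfk : ∀ w ∈ P', f' w ∈ Set.range y ∧ dist (f' w) (y k + nearestDist y k • A' w) ≤ 1 / 10 ^ 4 * nearestDist y k)
    (hexk : ∀ m, m ≠ k → dist (y m) (y k) ≤ (3 / 2 + 1 / 450) * nearestDist y k → ∃ w ∈ P', f' w = y m)
    {vk : EuclideanSpace ℝ (Fin 3)} (hvk : vk ∈ P) (hvk1 : ‖vk‖ = 1) (hfvk : f vk = y k) (hjk : j ≠ k) :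
    ∃ R₁ : EuclideanSpace ℝ (Fin 3) →ₗᵢ[ℝ] EuclideanSpace ℝ (Fin 3),
      (∀ x, ‖nearestDist y k • A' x - nearestDist y j • A (R₁ x)‖ ≤
        5 / 2 * (2 * (1 / 10 ^ 4) * nearestDist y j + 1 / 10 ^ 4 * nearestDist y k) * ‖x‖) ∧
      ∃ w₀ ∈ P', f' w₀ = y j ∧ R₁ w₀ = -vk := by
  set s := nearestDist y j with hs_def
  set s' := nearestDist y k with hs'_def
  have hs'0 : 0 ≤ s' := nearestDist_nonneg y k
  have hε0 : 0 ≤ 1 / 10 ^ 4 * s := by positivity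
  -- the back-pointer
  have hdjk : dist (y j) (y k) ≤ (3 / 2 + 1 / 450) * s' := dist_base_le hA hfj hvk hvk1 hfvk hsc
  obtain ⟨w₀, hw₀, hfw₀, hin₀⟩ := dict_base hfj hfk hexk hvk hfvk hjk hdjk
  have h₀ : ‖s' • A' w₀ - s • (A 0 - A vk)‖ ≤ 2 * (1 / 10 ^ 4) * s + 1 / 10 ^ 4 * s' := by
    rw [map_zero, zero_sub, smul_neg, sub_neg_eq_add]
    linarith
  -- the tetrahedron {0, vk, b, c} in P and its k-preimages
  obtain ⟨b, hb, c, hc, hb1, hc1, dvb, dvc, dbc, ivb, ivc, ibc⟩ := tetra_exists_pattern hP hvk hvk1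
  have hne_b : f b ≠ y k := by rw [← hfvk]; exact site_ne_of_adjacent hs hA hfj hb hvk (by rw [dist_comm]; exact dvb)
  have hne_c : f c ≠ y k := by rw [← hfvk]; exact site_ne_of_adjacent hs hA hfj hc hvk (by rw [dist_comm]; exact dvc)
  have nbv : ‖b - vk‖ = 1 := by rw [← dist_eq_norm, dist_comm]; exact dvb
  have ncv : ‖c - vk‖ = 1 := by rw [← dist_eq_norm, dist_comm]; exact dvc
  have hdb : dist (f b) (y k) ≤ (3 / 2 + 1 / 450) * s' := dict_reach_record hA hfj hvk hfvk hb hsc (by rw [nbv]; norm_num)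
  have hdc : dist (f c) (y k) ≤ (3 / 2 + 1 / 450) * s' := dict_reach_record hA hfj hvk hfvk hc hsc (by rw [ncv]; norm_num)
  obtain ⟨w₁, hw₁, hfw₁, h₁⟩ := dict_step hfj hfk hexk hvk hfvk hb hne_b hdb
  obtain ⟨w₂, hw₂, hfw₂, h₂⟩ := dict_step hfj hfk hexk hvk hfvk hc hne_c hdc
  -- norm classes of the preimages
  have hθ : (0 : ℝ) ≤ 1 / 1000 := by norm_num
  have hA0 := frame_insert_zero hθ hA
  have h0P : (0 : EuclideanSpace ℝ (Fin 3)) ∈ insert (0 : EuclideanSpace ℝ (Fin 3)) P := Finset.mem_insert_self 0 P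
  have hvkP : vk ∈ insert (0 : EuclideanSpace ℝ (Fin 3)) P := Finset.mem_insert_of_mem hvk
  have n₀ : ‖w₀‖ = 1 :=
    (dict_normClass_record hs hs'0 hsc hsc' hP' hA0 hA' h0P hvkP hw₀ h₀).1 (by rw [zero_sub, norm_neg, hvk1])
  have n₁ : ‖w₁‖ = 1 := (dict_normClass_record hs hs'0 hsc hsc' hP' hA hA' hb hvk hw₁ h₁).1 nbv
  have n₂ : ‖w₂‖ = 1 := (dict_normClass_record hs hs'0 hsc hsc' hP' hA hA' hc hvk hw₂ h₂).1 ncv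
  -- partners and Gram classes
  obtain ⟨g0, g1, g2, g01, g02, g12⟩ := partners_tetra hvk1 hb1 hc1 ivb ivc ibc
  have hw₀' : w₀ ∈ insert (0 : EuclideanSpace ℝ (Fin 3)) P' := Finset.mem_insert_of_mem hw₀
  have hw₁' : w₁ ∈ insert (0 : EuclideanSpace ℝ (Fin 3)) P' := Finset.mem_insert_of_mem hw₁
  have hw₂' : w₂ ∈ insert (0 : EuclideanSpace ℝ (Fin 3)) P' := Finset.mem_insert_of_mem hw₂
  have hbP : b ∈ insert (0 : EuclideanSpace ℝ (Fin 3)) P := Finset.mem_insert_of_mem hb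
  have hcP : c ∈ insert (0 : EuclideanSpace ℝ (Fin 3)) P := Finset.mem_insert_of_mem hc
  have e0 : (0 : EuclideanSpace ℝ (Fin 3)) - vk = -vk := zero_sub vk
  have i01 : inner ℝ w₀ w₁ = 1 / 2 := by
    rw [dict_gram_record hs hsc hsc' hP hP' hA hA' h0P hbP hw₀' hw₁' h₀ h₁ (by rw [n₀, e0, g0]) (by rw [n₁, g1]), e0, g01]
  have i02 : inner ℝ w₀ w₂ = 1 / 2 := by
    rw [dict_gram_record hs hsc hsc' hP hP' hA hA' h0P hcP hw₀' hw₂' h₀ h₂ (by rw [n₀, e0, g0]) (by rw [n₂, g2]), e0, g02]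
  have i12 : inner ℝ w₁ w₂ = 1 / 2 := by
    rw [dict_gram_record hs hsc hsc' hP hP' hA hA' hbP hcP hw₁' hw₂' h₁ h₂ (by rw [n₁, g1]) (by rw [n₂, g2]), g12]
  -- the abstract step
  have hd₀ : ‖(s' • A') w₀ - (s • A) (-vk)‖ ≤ 2 * (1 / 10 ^ 4) * s + 1 / 10 ^ 4 * s' := by
    rw [LinearMap.smul_apply, LinearMap.smul_apply, map_neg, smul_neg, sub_neg_eq_add]; linarith
  have hd₁ : ‖(s' • A') w₁ - (s • A) (b - vk)‖ ≤ 2 * (1 / 10 ^ 4) * s + 1 / 10 ^ 4 * s' := by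
    rw [LinearMap.smul_apply, LinearMap.smul_apply, map_sub]; exact h₁
  have hd₂ : ‖(s' • A') w₂ - (s • A) (c - vk)‖ ≤ 2 * (1 / 10 ^ 4) * s + 1 / 10 ^ 4 * s' := by
    rw [LinearMap.smul_apply, LinearMap.smul_apply, map_sub]; exact h₂
  obtain ⟨R₁, hR₀, hR₁, hR₂, hop⟩ := transport_step_exists n₀ n₁ n₂ i01 i02 i12 g0 g1 g2 g01 g02 g12 hd₀ hd₁ hd₂
  refine ⟨R₁, fun x => ?_, w₀, hw₀, hfw₀, hR₀⟩
  have := hop x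
  rwa [LinearMap.smul_apply, LinearMap.smul_apply] at this

end Summit.AtomisticToContinuum.Crystallization.Theorems.OverbindingBudgetAffineCompressedCutStep
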